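import Summits.CriticalPhenomena.SAWScalingLimit.Theorems.SAWCircleScreeningScreeningRecursionGeomA
import HarnessLib

/-!
# Screening recursion for `SAWCircleScreening`, part IV: lattice rays avoiding the near data

Route `SAWCircleScreening` of `CriticalPhenomena/SAWScalingLimit`, support item
`ScreeningRecursion` (stmt-CriticalPhenomena-5468). Continuation of part III (plane geometry of
the flat half-disc): we build walks of the mesh graph of `Ω ∖ K` (near data `K ⊆ B̄(c, r)`):

* `dist_meshPoint_of_adj` — adjacent lattice points have mesh points at distance `δ`;
* `reachable_mono_domain` — reachability in the mesh graph on mesh vertices is monotone in the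
  domain;
* `reachable_diff_of_walk_far` — a walk of the mesh graph of `Ω` all of whose vertices are at
  distance `> r + δ` from `c` is a walk of the mesh graph of `Ω ∖ K`;
* `ray_mem_and_reachable` — **the ray lemma**: a lattice ray from a point of positive height,
  along a direction that does not decrease the height, whose real points stay at distance in
  `(r, ρ₀)` from `c`, consists of mesh vertices of `Ω ∖ K` joined in its mesh graph.

All folklore. Tree anchors: `meshGraph_adj_iff`, `zdGraph_adj_iff`, `meshVertexGraph`.
-/

noncomputable section

open Set Metric Complex
open scoped ComplexConjugate
open Literature.Probability.LatticeModels

namespace Summit.CriticalPhenomena.SAWScalingLimit.Theorems.ScreeningRecursion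

/-! ## Mesh distance of neighbours -/

/-- Adjacent lattice points have mesh points at distance exactly `|δ|`; we state `≤ δ` for
`δ ≥ 0`, which is all we use. [folklore] -/
theorem dist_meshPoint_le_of_adj {δ : ℝ} (hδ : 0 ≤ δ) {x y : Site 2} (h : (zdGraph 2).Adj x y) :
    dist (meshPoint δ x) (meshPoint δ y) ≤ δ := by
  obtain ⟨i, hxy | hxy⟩ := (zdGraph_adj_iff x y).1 h
  · rw [hxy, meshPoint_add, dist_comm, dist_eq_norm, add_sub_cancel_left, norm_mul,
      Complex.norm_real, Real.norm_eq_abs, abs_of_nonneg hδ,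
      norm_toComplex_single i (Or.inl rfl), mul_one]
  · rw [hxy, meshPoint_add, dist_eq_norm, add_sub_cancel_left, norm_mul, Complex.norm_real,
      Real.norm_eq_abs, abs_of_nonneg hδ, norm_toComplex_single i (Or.inl rfl), mul_one]

/-- Points of the closed segment between the mesh points of two neighbours are within `δ` of the
first endpoint. [folklore] -/
theorem dist_le_of_mem_segment_of_adj {δ : ℝ} (hδ : 0 ≤ δ) {x y : Site 2}
    (h : (zdGraph 2).Adj x y) {z : ℂ} (hz : z ∈ segment ℝ (meshPoint δ x) (meshPoint δ y)) :
    dist z (meshPoint δ x) ≤ δ := by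
  have h1 := dist_add_dist_of_mem_segment hz
  have h2 : dist z (meshPoint δ x) ≤ dist (meshPoint δ x) (meshPoint δ y) := by
    rw [dist_comm z]; linarith [dist_nonneg (x := z) (y := meshPoint δ y)]
  exact h2.trans (dist_meshPoint_le_of_adj hδ h)

/-! ## Monotonicity of reachability in the domain -/

/-- The inclusion of mesh vertices of `Ω₁ ⊆ Ω₂` is a graph homomorphism of the mesh graphs on
mesh vertices (edges of `Ω₁` have their closed segment in `Ω̄₁ ⊆ Ω̄₂`). [folklore] -/
def meshVertexGraphHomOfSubset {Ω₁ Ω₂ : Set ℂ} (h : Ω₁ ⊆ Ω₂) (δ : ℝ) :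
    meshVertexGraph Ω₁ δ →g meshVertexGraph Ω₂ δ where
  toFun v := ⟨v.1, h v.2⟩
  map_rel' := by
    rintro ⟨x, hx⟩ ⟨y, hy⟩ hxy
    change (meshGraph Ω₂ δ).Adj x y
    have hxy' : (meshGraph Ω₁ δ).Adj x y := hxy
    rw [meshGraph_adj_iff] at hxy' ⊢
    exact ⟨hxy'.1, hxy'.2.trans (closure_mono h)⟩

/-- **Reachability is monotone in the domain**: joined in the mesh graph of `Ω₁ ⊆ Ω₂` implies
joined in the mesh graph of `Ω₂`. [folklore] -/
theorem reachable_mono_domain {Ω₁ Ω₂ : Set ℂ} (h : Ω₁ ⊆ Ω₂) {δ : ℝ} {x y : Site 2}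
    (hx : x ∈ meshVertices Ω₁ δ) (hy : y ∈ meshVertices Ω₁ δ)
    (hr : (meshVertexGraph Ω₁ δ).Reachable ⟨x, hx⟩ ⟨y, hy⟩) :
    (meshVertexGraph Ω₂ δ).Reachable ⟨x, h hx⟩ ⟨y, h hy⟩ :=
  hr.map (meshVertexGraphHomOfSubset h δ)

/-! ## Walks far from the near data survive its removal -/

/-- A closed segment all of whose points are outside `B̄(c, r)` and inside `Ω̄` lies in the
closure of `Ω ∖ K` for any `K ⊆ B̄(c, r)`. [folklore] -/
theorem subset_closure_diff_of_far {Ω K : Set ℂ} {c : ℂ} {r : ℝ} (hK : K ⊆ closedBall c r)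
    {S : Set ℂ} (hS : S ⊆ closure Ω) (hfar : ∀ z ∈ S, r < dist z c) : S ⊆ closure (Ω \ K) := by
  intro z hz
  have hU : IsOpen (closedBall c r)ᶜ := isClosed_closedBall.isOpen_compl
  have hzU : z ∈ (closedBall c r)ᶜ := fun h => (not_le.2 (hfar z hz)) (mem_closedBall.1 h)
  have h1 : z ∈ closure ((closedBall c r)ᶜ ∩ Ω) := hU.inter_closure ⟨hzU, hS hz⟩
  have hsub : (closedBall c r)ᶜ ∩ Ω ⊆ Ω \ K := fun w hw => ⟨hw.2, fun hwK => hw.1 (hK hwK)⟩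
  exact closure_mono hsub h1

/-- A mesh vertex of `Ω` at distance `> r` from `c` is a mesh vertex of `Ω ∖ K`, `K ⊆ B̄(c, r)`.
[folklore] -/
theorem mem_meshVertices_diff_of_far {Ω K : Set ℂ} {c : ℂ} {r δ : ℝ} (hK : K ⊆ closedBall c r)
    {x : Site 2} (hx : x ∈ meshVertices Ω δ) (hfar : r < dist (meshPoint δ x) c) :
    x ∈ meshVertices (Ω \ K) δ :=
  ⟨hx, fun h => (not_le.2 hfar) (mem_closedBall.1 (hK h))⟩

/-- **Far walks survive.** A walk of the mesh graph of `Ω` on mesh vertices all of whose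
vertices are at distance `> r + δ` from `c` joins its endpoints in the mesh graph of `Ω ∖ K`
(`K ⊆ B̄(c, r)`): its closed edges stay at distance `> r` from `c`. [folklore] -/
theorem reachable_diff_of_walk_far {Ω K : Set ℂ} {c : ℂ} {r δ : ℝ} (hδ : 0 ≤ δ)
    (hK : K ⊆ closedBall c r) {x y : meshVertices Ω δ} (p : (meshVertexGraph Ω δ).Walk x y)
    (hfar : ∀ v ∈ p.support, r + δ < dist (meshPoint δ v.1) c) :
    ∃ (hx : x.1 ∈ meshVertices (Ω \ K) δ) (hy : y.1 ∈ meshVertices (Ω \ K) δ),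
      (meshVertexGraph (Ω \ K) δ).Reachable ⟨x.1, hx⟩ ⟨y.1, hy⟩ := by
  induction p with
  | nil =>
    rename_i v
    have hv : r < dist (meshPoint δ v.1) c := by
      have := hfar v (by simp); linarith
    exact ⟨mem_meshVertices_diff_of_far hK v.2 hv, mem_meshVertices_diff_of_far hK v.2 hv,
      SimpleGraph.Reachable.refl _⟩
  | cons hadj q ih =>
    rename_i v w z
    have hv' : r + δ < dist (meshPoint δ v.1) c := hfar v (by simp)
    have hv : r < dist (meshPoint δ v.1) c := by linarith
    obtain ⟨hw, hz, hreach⟩ := ih (fun t ht => hfar t (by simp [ht]))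
    have hvK : v.1 ∈ meshVertices (Ω \ K) δ := mem_meshVertices_diff_of_far hK v.2 hv
    refine ⟨hvK, hz, SimpleGraph.Reachable.trans (SimpleGraph.Adj.reachable ?_) hreach⟩
    change (meshGraph (Ω \ K) δ).Adj v.1 w.1
    have hadj' : (meshGraph Ω δ).Adj v.1 w.1 := hadj
    rw [meshGraph_adj_iff] at hadj' ⊢
    refine ⟨hadj'.1, subset_closure_diff_of_far hK hadj'.2 fun t ht => ?_⟩
    have h1 : dist t (meshPoint δ v.1) ≤ δ := dist_le_of_mem_segment_of_adj hδ hadj'.1 ht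
    have h2 := dist_triangle (meshPoint δ v.1) t c
    rw [dist_comm (meshPoint δ v.1) t] at h2
    linarith

/-! ## The ray lemma -/

/-- **The ray lemma.** Let `Ω` be flat at `c` up to radius `ρ₀`, `K ⊆ B̄(c, r)`, `δ > 0`. Let
`a` be a lattice point whose mesh point `p` has positive height, `e = toComplex (single i s)`
(`s = ±1`) a lattice direction with `Im(e u) ≥ 0`, and `n` a number of steps such that every
real point `p + t e`, `0 ≤ t ≤ δ n`, is at distance in `(r, ρ₀)` from `c`. Then all the lattice
points `a + single i (k s)`, `k ≤ n`, have mesh points in `Ω ∖ K`, and the first and last are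
joined in the mesh graph of `Ω ∖ K` on mesh vertices. [folklore] -/
theorem ray_mem_and_reachable {Ω K : Set ℂ} {c u : ℂ} {ρ₀ r δ : ℝ}
    (hflat : Ω ∩ ball c ρ₀ = {z | 0 < ((z - c) * u).im} ∩ ball c ρ₀)
    (hK : K ⊆ closedBall c r) (hδ : 0 < δ) (a : Site 2) (i : Fin 2) {s : ℤ} (hs : s = 1 ∨ s = -1)
    (hh : 0 < ((meshPoint δ a - c) * u).im)
    (hrate : 0 ≤ (Site.toComplex (Pi.single i s) * u).im) (n : ℕ)
    (hrad : ∀ t : ℝ, 0 ≤ t → t ≤ δ * n →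
      r < dist (meshPoint δ a + (t : ℂ) * Site.toComplex (Pi.single i s)) c)
    (hin : ∀ t : ℝ, 0 ≤ t → t ≤ δ * n →
      dist (meshPoint δ a + (t : ℂ) * Site.toComplex (Pi.single i s)) c < ρ₀) :
    (∀ k : ℕ, k ≤ n → meshPoint δ (a + Pi.single i ((k : ℤ) * s)) ∈ Ω \ K) ∧
    ∀ b : Site 2, b = a + Pi.single i ((n : ℤ) * s) →
      ∃ (h0 : a ∈ meshVertices (Ω \ K) δ) (hb : b ∈ meshVertices (Ω \ K) δ),
        (meshVertexGraph (Ω \ K) δ).Reachable ⟨a, h0⟩ ⟨b, hb⟩ := by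
  set e := Site.toComplex (Pi.single i s) with he_def
  set p := meshPoint δ a with hp_def
  -- every real point of the ray up to time `δ n` lies in `Ω ∖ K`
  have hpt : ∀ t : ℝ, 0 ≤ t → t ≤ δ * n → p + (t : ℂ) * e ∈ Ω \ K := by
    intro t ht0 ht1
    have hball : p + (t : ℂ) * e ∈ ball c ρ₀ := mem_ball.2 (hin t ht0 ht1)
    have hheight : 0 < ((p + (t : ℂ) * e - c) * u).im := by
      rw [hgt_add_real_mul]
      exact add_pos_of_pos_of_nonneg hh (mul_nonneg ht0 hrate)
    refine ⟨(mem_iff_of_flat hflat hball).2 hheight, fun hKm => ?_⟩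
    have := mem_closedBall.1 (hK hKm)
    linarith [hrad t ht0 ht1]
  -- lattice points of the ray are such points
  have hlat : ∀ k : ℕ, k ≤ n → meshPoint δ (a + Pi.single i ((k : ℤ) * s)) = p + ((δ * k : ℝ) : ℂ) * e :=
    fun k _ => meshPoint_ray δ a i s k
  have hmem : ∀ k : ℕ, k ≤ n → meshPoint δ (a + Pi.single i ((k : ℤ) * s)) ∈ Ω \ K := by
    intro k hk
    rw [hlat k hk]
    refine hpt _ (by positivity) ?_
    exact mul_le_mul_of_nonneg_left (by exact_mod_cast hk) hδ.le
  refine ⟨hmem, ?_⟩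
  -- reachability by induction on the number of steps
  have h0 : a ∈ meshVertices (Ω \ K) δ := by
    have := hmem 0 (Nat.zero_le _)
    simpa using this
  have key : ∀ k : ℕ, k ≤ n → ∀ b : Site 2, b = a + Pi.single i ((k : ℤ) * s) →
      ∃ (hb : b ∈ meshVertices (Ω \ K) δ), (meshVertexGraph (Ω \ K) δ).Reachable ⟨a, h0⟩ ⟨b, hb⟩ := by
    intro k
    induction k with
    | zero =>
      intro _ b hb
      have hba : b = a := by rw [hb]; simp
      subst hba
      exact ⟨h0, SimpleGraph.Reachable.refl _⟩
    | succ k ih =>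
      intro hk b hb
      obtain ⟨hk', hreach⟩ := ih (Nat.le_of_succ_le hk) _ rfl
      have hk1 : b ∈ meshVertices (Ω \ K) δ := by rw [hb]; exact hmem (k + 1) hk
      refine ⟨hk1, hreach.trans (SimpleGraph.Adj.reachable ?_)⟩
      change (meshGraph (Ω \ K) δ).Adj (a + Pi.single i ((k : ℤ) * s)) b
      rw [hb]
      refine meshGraph_adj_iff.2 ⟨zdGraph_adj_ray_succ a i hs k, ?_⟩
      -- the closed edge consists of real points of the ray with times in `[δ k, δ (k+1)]`
      rw [hlat k (Nat.le_of_succ_le hk), hlat (k + 1) hk]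
      intro z hz
      have hkk : (δ * k : ℝ) ≤ δ * (k + 1 : ℕ) := by
        push_cast; nlinarith
      obtain ⟨t, ht0, ht1, rfl⟩ := exists_of_mem_segment_ray hkk hz
      refine subset_closure (hpt t ((by positivity : (0 : ℝ) ≤ δ * k).trans ht0) (ht1.trans ?_))
      exact mul_le_mul_of_nonneg_left (by exact_mod_cast hk) hδ.le
  intro b hb
  obtain ⟨hb', hr⟩ := key n le_rfl b hb
  exact ⟨h0, hb', hr⟩

end Summit.CriticalPhenomena.SAWScalingLimit.Theorems.ScreeningRecursion

end
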